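import Summits.Ventures.LatticeQCDFlow.Scoring.GaussianMovingAverage
import Summits.Ventures.LatticeQCDFlow.Scoring.MadrasSokalDataWindow

/-!
# The Madras–Sokal window of an eventually-flat autocorrelation curve exists — in particular for every MA(m) model and every `c` — and is strict off a countable set of `c`

HONEST FRAMING: exact (Metropolis-corrected) sampling algorithms for lattice gauge theory;
figures of merit are autocorrelation/cost numbers at stated couplings and volumes; no
continuum-physics claim.

Venture `LatticeQCDFlow` (cell pub-lqcd), sub-topic `Scoring`; FANOUT row 16 (`su2-base`), GEN-8.
NEW WORK of the cell over row 11's `MadrasSokalWindow` (`IsMSWindow`), GEN-8's `MadrasSokalDataWindow`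
(`IsStrictMSWindow`, `isStrictMSWindow_of_not_mem_range`), GEN-7's `MovingAverageCLT` / `GaussianMovingAverage`
(`maACF`, `maRho`, `maACF_eq_zero`); no definition; nothing cited as a fact.

The capstone `GaussianMovingAverageDataWindow` assumes a STRICT Madras–Sokal window of the population
curve `W ↦ tauIntWindow (maRho a) W`.  THIS FILE shows that hypothesis is all but automatic:

* `tauIntWindow_eq_of_eventually_zero` — if `ρ(t) = 0` for `t > M` then `tauIntWindow ρ W = tauIntWindow ρ M`
  for all `W ≥ M` (the curve is flat past `M`);
* **`exists_isMSWindow_of_eventually_zero`** — hence for EVERY real `c` the Madras–Sokal window EXISTS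
  (the first `W ≥ 1` with `c τ_W ≤ W` is at most `max M ⌈c τ_M⌉₊ ⊔ 1`);
* `maRho_eq_zero` (`t > m`), **`exists_isMSWindow_maRho`** — for the MA(m) autocorrelation `maRho a`
  and every real `c` the window exists; **`exists_isStrictMSWindow_maRho`** — and it is STRICT for every
  `c` outside the countable set `{W / tauIntWindow (maRho a) W : W ∈ ℕ}` (GEN-8 genericity).

So for Gaussian MA(m) data the only hypothesis left in `gaussianMA_tauIntWindow_clt_at_msWindowSel` beyond
`a ≠ 0`, `c > 0` is '`c` avoids countably many values and `W_max` is at least the window'.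

NOT CLAIMED: an explicit formula for the window; numbers.
-/

noncomputable section

open MeasureTheory Filter Finset
open scoped Topology

namespace Summit.Ventures.LatticeQCDFlow.Scoring

/-! ## Eventually-flat curves -/

section Flat

/-- Past the support of `ρ` the windowed `τ` is constant. -/
theorem tauIntWindow_eq_of_eventually_zero {ρ : ℕ → ℝ} {M : ℕ} (hρ : ∀ t, M < t → ρ t = 0) {W : ℕ}
    (hW : M ≤ W) : tauIntWindow ρ W = tauIntWindow ρ M := by
  obtain ⟨k, rfl⟩ := Nat.exists_eq_add_of_le hW
  simp only [tauIntWindow, sum_range_add, add_assoc]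
  congr 1
  rw [add_eq_left]
  exact sum_eq_zero fun j _ => hρ _ (by omega)

/-- **An eventually-flat curve has a Madras–Sokal window for every real `c`.** -/
theorem exists_isMSWindow_of_eventually_zero {ρ : ℕ → ℝ} {M : ℕ} (hρ : ∀ t, M < t → ρ t = 0) (c : ℝ) :
    ∃ W : ℕ, IsMSWindow c (fun W => tauIntWindow ρ W) W := by
  classical
  -- some `W ≥ 1` satisfies the inequality: any `W ≥ max M ⌈c τ_M⌉`
  have hex : ∃ W : ℕ, 1 ≤ W ∧ c * tauIntWindow ρ W ≤ W := by
    refine ⟨max (max M ⌈c * tauIntWindow ρ M⌉₊) 1, le_max_right _ _, ?_⟩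
    have hWM : M ≤ max (max M ⌈c * tauIntWindow ρ M⌉₊) 1 := (le_max_left _ _).trans (le_max_left _ _)
    rw [tauIntWindow_eq_of_eventually_zero hρ hWM]
    calc c * tauIntWindow ρ M ≤ ⌈c * tauIntWindow ρ M⌉₊ := Nat.le_ceil _
      _ ≤ ((max (max M ⌈c * tauIntWindow ρ M⌉₊) 1 : ℕ) : ℝ) := by
          exact_mod_cast (le_max_right _ _).trans (le_max_left _ _)
  refine ⟨Nat.find hex, (Nat.find_spec hex).1, (Nat.find_spec hex).2, fun W' hW'1 hW'lt => ?_⟩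
  have hmin := Nat.find_min hex hW'lt
  exact not_le.mp fun h => hmin ⟨hW'1, h⟩

end Flat

/-! ## The MA(m) curve -/

section MA

variable {m : ℕ}

/-- The MA(m) autocorrelation vanishes past lag `m`. -/
theorem maRho_eq_zero (a : Fin (m + 1) → ℝ) {t : ℕ} (ht : m < t) : maRho a t = 0 := by
  rw [maRho, maACF_eq_zero a ht, zero_div]

/-- **The Madras–Sokal window of the MA(m) curve exists for every real `c`.** -/
theorem exists_isMSWindow_maRho (a : Fin (m + 1) → ℝ) (c : ℝ) :
    ∃ W : ℕ, IsMSWindow c (fun W => tauIntWindow (maRho a) W) W :=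
  exists_isMSWindow_of_eventually_zero (fun _ ht => maRho_eq_zero a ht) c

/-- **… and it is STRICT for every `c` off the countable set `{W / τ_W}`** — the hypothesis of
`GaussianMovingAverageDataWindow` holds for all but countably many scorer constants. -/
theorem exists_isStrictMSWindow_maRho (a : Fin (m + 1) → ℝ) {c : ℝ}
    (hcr : c ∉ Set.range fun W : ℕ => (W : ℝ) / tauIntWindow (maRho a) W) :
    ∃ W : ℕ, IsStrictMSWindow c (fun W => tauIntWindow (maRho a) W) W := by
  obtain ⟨W, hW⟩ := exists_isMSWindow_maRho a c
  exact ⟨W, isStrictMSWindow_of_not_mem_range hW hcr⟩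

end MA

end Summit.Ventures.LatticeQCDFlow.Scoring

end
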